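import Summits.ResolutionOfSingularities.ResolutionOfSingularities.Theorems.RadicialJungCleanModelsSufficeGameEndOverlap

/-!
# Route `RadicialJung`, crux `CleanModelsSuffice`, line `Sketch`: the END STATE of the game —
# the family of Kato charts on `V^L` and its four properties

Helper for the registered stub `stub_gameEndResolves` of the skeleton of
`Summit.ResolutionOfSingularities.ResolutionOfSingularities.Theses.RadicialJung.CleanModelsSuffice`
(stmt-ResolutionOfSingularities-15883). For an end state `S` the charts on `V^L = normalizationIn V L`
are indexed by `{v // v ∈ S.tor} ⊕ Unit`: a TOROIDAL point `v` carries its Kummer chart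
`kφ v : P_{aK v} → Γ(V^L, ι⁻¹ U' v)` (`…GameEndSections`), and the single index `inr ()` carries the
trivial chart on the preimage of the (open) complement of the toroidal locus, where all stalks of
`V^L` are regular. This file proves the four clauses of `atlasOfCharts`: the domains cover `V^L`
(`cover`), the monoids are fs (`fs`), every chart is log regular at every point of its domain
(`isLogRegularLocal_chart`: `…GameEndChart`), and any two charts are compatible at a common point
(`chart_compatible`: a unit value is matched by `1`; a non-unit value of a Kummer chart at `x` means a
charged divisor through `w = ι x`, so `w` is toroidal — excluding the trivial chart — and for two
Kummer charts `…GameEndOverlap.exists_associated_kci` applies through the stalk isomorphism).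
-/

noncomputable section

set_option linter.dupNamespace false -- mandated namespace of this single-conjunct summit

open CategoryTheory AlgebraicGeometry TopologicalSpace IsLocalRing
open Literature.AlgebraicGeometry.Resolution

namespace Summit.ResolutionOfSingularities.ResolutionOfSingularities.Theorems.RadicialJung.CleanModelsSuffice

attribute [local instance] stalkAlgebra isScalarTower_stalkAlgebra

namespace GameState

variable {p : ℕ} {V₀ : Scheme.{0}} [IsIntegral V₀] {L : Type} [Field L] [Algebra V₀.functionField L]
  {V : Scheme.{0}} [IsIntegral V] {π : V ⟶ V₀} [IsDominant π] (S : GameState p V₀ L V π)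
  [Algebra V.functionField L]

/-! ## The family -/

/-- The complement of the toroidal locus, an open of `V`. [folklore] -/
def torCompl (S : GameState p V₀ L V π) (H : S.EndHyp) : V.Opens :=
  ⟨S.torᶜ, (S.isClosed_tor H).isOpen_compl⟩

/-- The chart domains: `ι⁻¹ U' v` for a toroidal `v`; `ι⁻¹ (V ∖ tor)` for the trivial chart.
[folklore] -/
def dom (S : GameState p V₀ L V π) (H : S.EndHyp) : {v : V // v ∈ S.tor} ⊕ Unit → (normalizationIn V L).Opens
  | Sum.inl v => normalizationInι V L ⁻¹ᵁ S.U' H v.2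
  | Sum.inr _ => normalizationInι V L ⁻¹ᵁ S.torCompl H

/-- The ranks of the chart lattices. [folklore] -/
def rk (S : GameState p V₀ L V π) : {v : V // v ∈ S.tor} ⊕ Unit → ℕ
  | Sum.inl v => S.nC v.1 + 1
  | Sum.inr _ => 0

/-- The chart monoids: the Kummer monoid of the normalised exponents at a toroidal point, the zero
monoid otherwise. [folklore] -/
def mon (S : GameState p V₀ L V π) (H : S.EndHyp) : ∀ i : {v : V // v ∈ S.tor} ⊕ Unit,
    AddSubmonoid (Fin (S.rk i) → ℤ)
  | Sum.inl v => kummerMonoid p (S.aK H v.2)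
  | Sum.inr _ => ⊤

/-- The charts: the Kummer chart by sections of `V^L`, the trivial chart otherwise. [folklore] -/
def chart (S : GameState p V₀ L V π) (H : S.EndHyp) : ∀ i : {v : V // v ∈ S.tor} ⊕ Unit,
    Multiplicative (S.mon H i) →* Γ(normalizationIn V L, S.dom H i)
  | Sum.inl v => S.kφ H v.2
  | Sum.inr _ => 1

/-! ## The four properties -/

/-- **The chart domains cover `V^L`.** [folklore] -/
theorem cover (H : S.EndHyp) (x : normalizationIn V L) : ∃ i, x ∈ S.dom H i := by
  by_cases h : normalizationInι V L x ∈ S.tor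
  · exact ⟨Sum.inl ⟨_, h⟩, S.mem_U' H h⟩
  · exact ⟨Sum.inr (), h⟩

/-- A point of the domain of the trivial chart lies over a non-toroidal point. [folklore] -/
theorem not_mem_tor_of_mem_dom_inr (H : S.EndHyp) {x : normalizationIn V L}
    (hx : x ∈ S.dom H (Sum.inr ())) : normalizationInι V L x ∉ S.tor :=
  fun h => (hx : normalizationInι V L x ∈ S.torᶜ) h

/-- **The chart monoids are fs.** [folklore] -/
theorem fs (H : S.EndHyp) (i : {v : V // v ∈ S.tor} ⊕ Unit) :
    (S.mon H i).FG ∧ (S.mon H i).NSMulSaturated ∧ Submodule.span ℤ (S.mon H i : Set (Fin (S.rk i) → ℤ)) = ⊤ := by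
  rcases i with ⟨v, hv⟩ | _
  · exact kummerMonoid_fs p H.prime.pos _
  · change (⊤ : AddSubmonoid (Fin 0 → ℤ)).FG ∧ (⊤ : AddSubmonoid (Fin 0 → ℤ)).NSMulSaturated ∧
      Submodule.span ℤ ((⊤ : AddSubmonoid (Fin 0 → ℤ)) : Set (Fin 0 → ℤ)) = ⊤
    exact ⟨AddMonoid.fg_def.mp inferInstance, fun _ _ _ => Or.inr (AddSubmonoid.mem_top _),
      Subsingleton.elim _ _⟩

/-- **Every chart is log regular at every point of its domain.** [folklore] -/
theorem isLogRegularLocal_chart (H : S.EndHyp) (i : {v : V // v ∈ S.tor} ⊕ Unit)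
    (x : normalizationIn V L) (hx : x ∈ S.dom H i) :
    LogChart.IsLogRegularLocal (S.mon H i)
      (((normalizationIn V L).presheaf.germ (S.dom H i) x hx).hom.toMonoidHom.comp (S.chart H i)) := by
  rcases i with ⟨v, hv⟩ | _
  · exact S.isLogRegularLocal_kφ H hv x hx
  · exact (LogChart.isLogRegularLocal_zero_iff _ _).mpr
      (S.isRegularLocalRing_stalk_of_not_mem_tor H x (S.not_mem_tor_of_mem_dom_inr H hx))

/-- A Kummer chart value which is not a unit at `x` forces `ι x` to be toroidal (a boundary
section of the chart vanishes at `ι x`, so a charged divisor passes). [folklore] -/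
theorem mem_tor_of_not_isUnit (H : S.EndHyp) {v : V} (hv : v ∈ S.tor) (x : normalizationIn V L)
    (hx : x ∈ S.dom H (Sum.inl ⟨v, hv⟩)) (c : S.mon H (Sum.inl ⟨v, hv⟩))
    (hunit : ¬ IsUnit ((normalizationIn V L).presheaf.germ (S.dom H (Sum.inl ⟨v, hv⟩)) x hx
      (S.chart H (Sum.inl ⟨v, hv⟩) (Multiplicative.ofAdd c)))) :
    ∃ k, S.tw H hv (normalizationInι V L x) hx k ∈ maximalIdeal (V.presheaf.stalk (normalizationInι V L x)) := by
  by_contra hB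
  push Not at hB
  obtain ⟨e, he⟩ := S.exists_stalkIso H x
  have h1 := S.isUnit_kci H hv _ hx hB (Multiplicative.ofAdd c)
  rw [← S.stalkIso_germ_kφ H hv x hx e he] at h1
  exact hunit ((isUnit_map_iff e _).mp h1)

/-- **Any two charts are compatible at a common point.** [folklore] -/
theorem chart_compatible (H : S.EndHyp) (i j : {v : V // v ∈ S.tor} ⊕ Unit) (x : normalizationIn V L)
    (hi : x ∈ S.dom H i) (hj : x ∈ S.dom H j) (c : S.mon H i) :
    ∃ c' : S.mon H j, Associated ((normalizationIn V L).presheaf.germ (S.dom H i) x hi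
        (S.chart H i (Multiplicative.ofAdd c)))
      ((normalizationIn V L).presheaf.germ (S.dom H j) x hj (S.chart H j (Multiplicative.ofAdd c'))) := by
  have hone : (normalizationIn V L).presheaf.germ (S.dom H j) x hj
      (S.chart H j (Multiplicative.ofAdd (0 : S.mon H j))) = 1 := by
    rw [ofAdd_zero, map_one, map_one]
  rcases i with ⟨v, hv⟩ | _
  · by_cases hunit : IsUnit ((normalizationIn V L).presheaf.germ (S.dom H (Sum.inl ⟨v, hv⟩)) x hi
        (S.chart H (Sum.inl ⟨v, hv⟩) (Multiplicative.ofAdd c)))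
    · exact ⟨0, by rw [hone]; exact associated_one_iff_isUnit.mpr hunit⟩
    · obtain ⟨k, hk⟩ := S.mem_tor_of_not_isUnit H hv x hi c hunit
      rcases j with ⟨v', hv'⟩ | _
      · -- two Kummer charts
        obtain ⟨e, he⟩ := S.exists_stalkIso H x
        obtain ⟨c', hc'⟩ := S.exists_associated_kci H hv hv' _ hi hj c
        refine ⟨c', ?_⟩
        rw [← S.stalkIso_germ_kφ H hv x hi e he, ← S.stalkIso_germ_kφ H hv' x hj e he] at hc'
        have h := hc'.map e.symm.toMonoidHom
        have h' : Associated
            ((normalizationIn V L).presheaf.germ (normalizationInι V L ⁻¹ᵁ S.U' H hv) x hi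
              (S.kφ H hv (Multiplicative.ofAdd c)))
            ((normalizationIn V L).presheaf.germ (normalizationInι V L ⁻¹ᵁ S.U' H hv') x hj
              (S.kφ H hv' (Multiplicative.ofAdd c'))) := by
          simpa using h
        exact h'
      · -- the trivial chart: `ι x` is not toroidal, yet a charged divisor passes
        exfalso
        refine S.not_mem_tor_of_mem_dom_inr H hj ⟨(S.divOf H.endCond hv k).1, ?_⟩
        exact ((S.near_of_mem_U' H hv hi).chargedAt_iff S H _).mpr
          ⟨(S.mem_support_divOf_iff H hv _ hi k).mpr hk, S.chargedAt_divOf H.endCond hv k⟩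
  · refine ⟨0, ?_⟩
    rw [hone]
    change Associated ((normalizationIn V L).presheaf.germ (S.dom H (Sum.inr _)) x hi
      ((1 : Multiplicative (S.mon H (Sum.inr ())) →* _) (Multiplicative.ofAdd c))) 1
    rw [MonoidHom.one_apply, map_one]

end GameState

/-- The chart domains of an end state cover `V^L` (explicit-binder form, the registered interface of
this helper file). [folklore] -/
theorem gameState_cover {p : ℕ} {V₀ : Scheme.{0}} [IsIntegral V₀] {L : Type} [Field L]
    [Algebra V₀.functionField L] {V : Scheme.{0}} [IsIntegral V] {π : V ⟶ V₀} [IsDominant π]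
    (S : GameState p V₀ L V π) [Algebra V.functionField L] (H : S.EndHyp) (x : normalizationIn V L) :
    ∃ i, x ∈ S.dom H i :=
  S.cover H x

end Summit.ResolutionOfSingularities.ResolutionOfSingularities.Theorems.RadicialJung.CleanModelsSuffice

end
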